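import Literature.NumberTheory.EllipticCurves.EichlerShimuraOptimalQuotientLattice
import Literature.NumberTheory.EllipticCurves.NewformsDepletion
import Literature.NumberTheory.EllipticCurves.NewformsHeckeProofs
import Literature.NumberTheory.EllipticCurves.PeriodLatticeRationalityUnconditionalProofs
import Literature.NumberTheory.EllipticCurves.EichlerShimuraConstructionProofs
import Literature.NumberTheory.EllipticCurves.EichlerShimuraCongruenceHondaProofs
import Literature.NumberTheory.EllipticCurves.AnalyticIsogenyDescentProofs
import Literature.NumberTheory.EllipticCurves.ModularCurveNeronLatticeProofs
import Literature.NumberTheory.EllipticCurves.GlobalMinimalModelProofs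
import Literature.NumberTheory.EllipticCurves.IsogenyDualProofs
import Literature.NumberTheory.EllipticCurves.ComplexMultiplicationLFunctionIsogenyHoldsProofs
import Literature.NumberTheory.EllipticCurves.LFunctionPrimeCoeff
import HarnessLib

/-!
# The named facts `eichlerShimura_depletedOptimalQuotient_periodLattice(_of_dvd)` HOLD — unconditionally, by the analytic
# road `E_f = ℂ/Λ_f`, `(∏ℓ²)Λ_g ⊆ Λ_f`, `A = ℂ/Λ_g` over `ℚ`, and the Eichler–Shimura congruence at almost all `p`
# (Knapp 1993 Thm. 11.74 (d)(e); Cremona 1997 §2.14; Shimura 1971 Thm. 7.14–7.15; Atkin–Lehner 1970 §3)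

Topic `Literature/NumberTheory/EllipticCurves`; the proofs-only sibling of `EichlerShimuraOptimalQuotientLattice.lean` (THEOREMS
ONLY — no definition, no named fact, no `sorry`, no new axiom). It DISCHARGES the two named facts of that file,

* `eichlerShimura_depletedOptimalQuotient_periodLattice_of_dvd_holds : eichlerShimura_depletedOptimalQuotient_periodLattice_of_dvd`,
* `eichlerShimura_depletedOptimalQuotient_periodLattice_holds : eichlerShimura_depletedOptimalQuotient_periodLattice`,

verbatim as stated there (the defs are untouched): for a newform `f ∈ S₂(Γ₀(N))` with integer coefficients, a nonempty finite set
`S` of primes, a level `L` with `N·∏_{ℓ∈S} ℓ² ∣ L`, and the `S`-depleted form `g ∈ S₂(Γ₀(L))` (`a_n(g) = 𝟙_{(n,S)=1} a_n(f)`), there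
are an elliptic curve `A/ℚ` (globally minimal model), a Néron-type period pair `L_A` and `c ∈ ℚ^×` with `Λ_A = c·Λ_g`
(`Λ_g = periodLattice g`) and `a_p(A) = a_p(g)` for all but finitely many primes `p`.

HONEST FRAMING. The facts are consumed by the BSD routes ThetaPartnerAtTwo / ResidualThetaTransportAtTwo (bundle
`PublishedInputsHeckeAtTwo`, conjunct "ES"). Discharging them makes those consumers unconditional IN THIS CONJUNCT ONLY and as
typed; no summit statement (BirchSwinnertonDyer) is proved by any of this.

THE PROOF. The def's docstring assembles the fact along the JACOBIAN road (Agashe–Ribet–Stein 2006 §3: the optimal quotient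
`J₀(L)/I_g J₀(L)`; Shimura Thm. 3.43 / Cor. 3.44; Knapp Thm. 11.74 (d)). The tree proves the same typed statement along the
ANALYTIC road of Knapp 1993, Thm. 11.74 (d)–(e) and Cremona 1997, §2.14 ("`E_f = ℂ/Λ_f` … since `E_f` is defined over `ℚ`, the
numbers `c₄` and `c₆` are rational"), every step of which is a theorem of `Literature/`:
1. `E_f = ℂ/Λ_f` over `ℚ`: `Λ_f` is spanned by a period pair `L_f` (`IsNewform0.exists_periodPair_of_coeffField_eq_bot`, Shimura
   1971 Thm. 7.14) with `g₂(L_f) = −4a₄`, `g₃(L_f) = −4a₆`, `a₄, a₆ ∈ ℚ` (`IsNewform0.exists_rat_g₂_g₃_of_lattice_eq_periodLattice`,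
   Shimura's `Aut(ℂ)`-descent); `W₀ : y² = x³ + a₄x + a₆` is an elliptic curve over `ℚ` whose Néron-type lattice is EXACTLY `Λ_f`
   (`isElliptic_shortModel`, `isNeronLatticeOf_shortModel`).
2. `DepletedForm.exists_depletedLatticeCurve_isIsogenous_of_mul_mem` (§1): from ANY elliptic `W/ℚ` with a Néron-type `L_W` and
   `c₀ ∈ ℚ^×` with `c₀Λ_f ⊆ Λ_W` one gets a globally minimal `A/ℚ`, `L_A`, `c ∈ ℚ^×` with `Λ_A = c·Λ_g` and `A ~_ℚ W`: by
   `(∏ℓ²)Λ_g ⊆ Λ_f` (`DepletedForm.mul_mem_periodLattice_of_mem_periodLattice_depleted`, `NewformsDepletion.lean`, the Atkin–Lehner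
   sieve), discreteness of `Λ_g`, rationality of `g₂(Λ_g), g₃(Λ_g)`, the short model of `ℂ/Λ_g`, a global minimal model, and
   analytic isogeny descent (`isIsogenous_of_forall_mul_mem_lattice`). Applied with `W = W₀`, `L_W = L_f`, `c₀ = 1`. (This is the
   lattice-hypothesis form of the Summit-side theorem `…MazurTateCongruenceAtTwoR.DepletedLattice.exists_depletedLatticeCurve_isIsogenous`,
   p636031, which takes `IsNewformOf W f` and the Manin-constant fact instead.)
3. `a_p`: `L(A, s) = L(W₀, s)` (`WeierstrassCurve.IsIsogenous.LFunction_eq`, Faltings 1983 §5 Kor. 2 (i)⇒(iv), Knapp Thm. 11.67 —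
   a tree theorem); `a_p(f) = L(W₀, s)_p` for all but finitely many `p` — the Eichler–Shimura congruence for `ℂ/Λ_f` by Honda's
   method (`congruenceRelation_cofinite_of_int`, Shimura 1971 Thm. 7.14–7.15 / Knapp Thm. 11.74 (e), unconditional in the tree);
   `a_p(A) = L(A, s)_p` at the primes `p ∤ Δ_min(A)` (`WeierstrassCurve.LFunction_apply_prime_eq_frobeniusTrace`); `a_p(g) = a_p(f)`
   for `p ∉ S`. The exceptional set lies in `{p ≤ |Δ_min(A)|} ∪ S ∪ {congruence exceptions}`, a finite set.
Why not through `eichlerShimuraConstruction` (the Summit-side reduction `…RDepletedLatticeOfConstruction`, p637460): that named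
fact asks for `a_n(E_f) = a_n(f)` at EVERY `n` (Carayol), which the tree has only modulo modularity
(`eichlerShimuraConstruction_of_exists_isNewformOf`); the targets need agreement at almost all `p` only, which step 3 supplies
unconditionally.

## References

* A. W. Knapp, *Elliptic Curves*, Math. Notes 40, Princeton (1993): Thm. 11.74 (d)(e) with its proof (PDF p. 287),
  Thm. 11.67 (PDF p. 281). [Knapp1993]
* G. Shimura, *Introduction to the Arithmetic Theory of Automorphic Functions* (1971): Thm. 7.14, Thm. 7.15. [ShimuraIATAF1971]
* J. E. Cremona, *Algorithms for modular elliptic curves*, 2nd ed. (1997): §2.4, §2.14. [CremonaAlgorithms1997]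
* A. Agashe, K. Ribet, W. Stein, *The Manin constant*, PAMQ 2 (2006): §2 (p. 618), §3 (pp. 620–621). [AgasheRibetStein2006]
* A. O. L. Atkin, J. Lehner, Math. Ann. 185 (1970): §3. [AtkinLehner1970]
* T. Honda, J. Math. Soc. Japan 22 (1970): §6.2, Thm. 9. [Honda1970]
* G. Faltings, Invent. Math. 73 (1983): §5 Korollar 2. [Faltings1983Endlichkeit]
-/

noncomputable section

open scoped MatrixGroups ModularForm

open CongruenceSubgroup

namespace Literature.NumberTheory.EllipticCurves.ModularForms

/-! ## §1. The curve `ℂ/Λ_g` over `ℚ`, isogenous to any curve whose Néron lattice contains a multiple of `Λ_f` -/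

namespace DepletedForm

/-- **The depleted-lattice curve, lattice-hypothesis form.** Let `f ∈ S₂(Γ₀(N))` be a newform with integer coefficients,
`S` a finite set of primes, `L` a level with `N·∏_{ℓ∈S} ℓ² ∣ L`, `g ∈ S₂(Γ₀(L))` the `S`-depleted form, and let `W/ℚ` be ANY
elliptic curve with a Néron-type period pair `L_W` and `c₀ ∈ ℚ^×` such that `c₀·Λ_f ⊆ Λ_W`. Then there are a globally
minimal elliptic curve `A/ℚ`, a Néron-type period pair `L_A` of `A` and `c ∈ ℚ^×` with `Λ_A = c·Λ_g`, and `A ~_ℚ W`.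
Construction (Knapp Thm. 11.74 (d) / Cremona §2.14 for `Λ_g`): `(∏ℓ²)Λ_g ⊆ Λ_f` (`mul_mem_periodLattice_of_mem_periodLattice_depleted`)
and `c₀Λ_f ⊆ Λ_W` make `Λ_g` discrete (`discreteTopology_periodLattice_of_mul_mem`), hence spanned by a period pair
(`exists_periodPair_lattice_eq_periodLattice`); `g₂(Λ_g), g₃(Λ_g) ∈ ℚ` (`PeriodPair.ratCast_g₂_g₃_of_lattice_eq_periodLattice`,
`g ≠ 0` with rational coefficients); the short model of `ℂ/Λ_g` (`isElliptic_shortModel`, `isNeronLatticeOf_shortModel`), a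
global minimal model `A` (`hasGlobalMinimalModel_rat_holds`, Néron lattice rescaled by `u ∈ ℚ^×`, `IsNeronLatticeOf.smul`), and
`A ~_ℚ W` from `(c₀∏ℓ²/u)·Λ_A ⊆ Λ_W` by analytic isogeny descent (`isIsogenous_of_forall_mul_mem_lattice`). The Summit-side
theorem `…MazurTateCongruenceAtTwoR.DepletedLattice.exists_depletedLatticeCurve_isIsogenous` (p636031) is the case where `c₀`
comes from `IsNewformOf.exists_maninConstant_ne_zero`. [cite: Knapp1993, Thm. 11.74 (d)] [cite: CremonaAlgorithms1997, §2.14]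
[cite: AtkinLehner1970, §3] -/
theorem exists_depletedLatticeCurve_isIsogenous_of_mul_mem
    (W : WeierstrassCurve ℚ) [W.IsElliptic] {LW : PeriodPair} (hLW : IsNeronLatticeOf (W.baseChange ℂ) LW)
    {N : ℕ} [NeZero N] {f : CuspForm (Gamma0 N) 2} (hf : IsNewform0 f) (hint : ∀ n : ℕ, ∃ z : ℤ, cuspCoeff f n = z)
    {c₀ : ℚ} (hc₀ : c₀ ≠ 0) (hc₀Λ : ∀ z ∈ periodLattice f, (c₀ : ℂ) * z ∈ LW.lattice)
    (S : Finset ℕ) (hS : ∀ ℓ ∈ S, ℓ.Prime) (L : ℕ) [NeZero L] (hNL : N * ∏ ℓ ∈ S, ℓ ^ 2 ∣ L)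
    (g : CuspForm (Gamma0 L) 2) (hg : ∀ n : ℕ, cuspCoeff g n = if ∃ ℓ ∈ S, ℓ ∣ n then 0 else cuspCoeff f n) :
    ∃ (A : WeierstrassCurve ℚ) (_ : A.IsElliptic) (_ : A.IsGloballyMinimal) (LA : PeriodPair) (c : ℚ),
      IsNeronLatticeOf (A.baseChange ℂ) LA ∧ c ≠ 0 ∧
      (∀ z : ℂ, z ∈ LA.lattice ↔ ∃ w ∈ periodLattice g, z = (c : ℂ) * w) ∧ WeierstrassCurve.IsIsogenous W A := by
  classical
  set D : ℕ := ∏ ℓ ∈ S, ℓ ^ 2 with hDdef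
  have hD0 : (D : ℂ) ≠ 0 := by
    rw [hDdef]; exact_mod_cast (Finset.prod_ne_zero_iff.mpr fun ℓ hℓ ↦ pow_ne_zero 2 (hS ℓ hℓ).ne_zero)
  -- `f` is a Hecke eigenform: `T_p f = a_p(f) f`
  have hTf : ∀ (p : ℕ) (hp : p.Prime), (haveI : NeZero p := ⟨hp.ne_zero⟩; heckeT (Gamma0 N) 2 p f) = cuspCoeff f p • f :=
    fun p hp ↦ by haveI : NeZero p := ⟨hp.ne_zero⟩; exact hf.heckeT_eq_coeff_smul hp
  -- `(∏ℓ²) Λ_g ⊆ Λ_f`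
  have hDΛ := mul_mem_periodLattice_of_mem_periodLattice_depleted f hint hTf S hS L hNL g hg
  -- `Λ_g` is discrete, hence spanned by a period pair
  have hg1 : cuspCoeff g 1 = 1 := by
    rw [hg 1, if_neg]
    · exact hf.2.2
    · rintro ⟨ℓ, hℓ, hd⟩
      exact (hS ℓ hℓ).ne_one (Nat.dvd_one.mp hd)
  have hg0 : g ≠ 0 := by
    intro h
    have : cuspCoeff g 1 = 0 := by
      rw [h]
      change (UpperHalfPlane.qExpansion 1 ⇑(0 : CuspForm (Gamma0 L) 2)).coeff 1 = 0
      rw [CuspForm.coe_zero, UpperHalfPlane.qExpansion_zero]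
      simp
    rw [hg1] at this
    exact one_ne_zero this
  haveI : DiscreteTopology (AddSubgroup.toIntSubmodule (periodLattice g)) := by
    refine discreteTopology_periodLattice_of_mul_mem g (L := LW) (c := (c₀ : ℂ) * D)
      (mul_ne_zero (by exact_mod_cast hc₀) hD0) fun z hz ↦ ?_
    rw [mul_assoc]
    exact hc₀Λ _ (hDΛ z hz)
  obtain ⟨Lg, hLg⟩ := exists_periodPair_lattice_eq_periodLattice g hg0
  have hLg' : ∀ x, x ∈ Lg.lattice ↔ x ∈ periodLattice g := fun x ↦ by
    rw [← hLg]; rfl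
  -- `g₂(Λ_g), g₃(Λ_g) ∈ ℚ`: the short model of `ℂ/Λ_g` over `ℚ`
  have hrat : ∀ n, ∃ q : ℚ, (q : ℂ) = cuspCoeff g n := fun n ↦ by
    rw [hg n]
    split_ifs
    · exact ⟨0, by simp⟩
    · obtain ⟨z, hz⟩ := hint n
      exact ⟨z, by rw [hz, Rat.cast_intCast]⟩
  obtain ⟨⟨q₂, hq₂⟩, ⟨q₃, hq₃⟩⟩ := PeriodPair.ratCast_g₂_g₃_of_lattice_eq_periodLattice g hg0 hrat Lg hLg'
  set a₄ : ℚ := -q₂ / 4 with ha₄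
  set a₆ : ℚ := -q₃ / 4 with ha₆
  have h₂ : Lg.g₂ = -4 * (a₄ : ℂ) := by rw [← hq₂, ha₄]; push_cast; ring
  have h₃ : Lg.g₃ = -4 * (a₆ : ℂ) := by rw [← hq₃, ha₆]; push_cast; ring
  set E : WeierstrassCurve ℚ := { a₁ := 0, a₂ := 0, a₃ := 0, a₄ := a₄, a₆ := a₆ } with hE
  haveI hEe : E.IsElliptic := isElliptic_shortModel h₂ h₃
  have hEL : IsNeronLatticeOf (E.baseChange ℂ) Lg := isNeronLatticeOf_shortModel h₂ h₃
  -- a global minimal model `A = C • E`, with Néron lattice `u Λ_g`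
  obtain ⟨C, hC⟩ := WeierstrassCurve.hasGlobalMinimalModel_rat_holds E
  set c : ℚ := (C.u : ℚ) with hcdef
  have hc : c ≠ 0 := C.u.ne_zero
  have hcC : (c : ℂ) ≠ 0 := by exact_mod_cast hc
  have hLA : IsNeronLatticeOf ((C • E).baseChange ℂ) (Lg.mulLeft (c : ℂ) hcC) := by
    have hmap : (C • E).baseChange ℂ = (C.map (algebraMap ℚ ℂ)) • E.baseChange ℂ := by
      simp only [WeierstrassCurve.baseChange, WeierstrassCurve.map_variableChange]
    have h := hEL.smul (C.map (algebraMap ℚ ℂ))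
    rw [hmap]
    convert h using 2
    simp [hcdef, WeierstrassCurve.VariableChange.map_u]
  have hlat : ∀ z : ℂ, z ∈ (Lg.mulLeft (c : ℂ) hcC).lattice ↔ ∃ w ∈ periodLattice g, z = (c : ℂ) * w := fun z ↦ by
    rw [PeriodPair.mem_mulLeft_lattice, hLg']
    constructor
    · intro hz
      exact ⟨_, hz, by rw [← mul_assoc, mul_inv_cancel₀ hcC, one_mul]⟩
    · rintro ⟨w, hw, rfl⟩
      rwa [← mul_assoc, inv_mul_cancel₀ hcC, one_mul]
  -- `A ~ W`: `(c₀ D / c) Λ_A ⊆ Λ_W`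
  have hAW : WeierstrassCurve.IsIsogenous (C • E) W := by
    refine isIsogenous_of_forall_mul_mem_lattice hLA.1 hLA.2 hLW.1 hLW.2 (c := c₀ * D / c)
      (div_ne_zero (mul_ne_zero hc₀ (by exact_mod_cast (Finset.prod_ne_zero_iff.mpr fun ℓ hℓ ↦ pow_ne_zero 2 (hS ℓ hℓ).ne_zero))) hc)
      fun z hz ↦ ?_
    obtain ⟨w, hw, rfl⟩ := (hlat z).mp hz
    have : ((c₀ * D / c : ℚ) : ℂ) * ((c : ℂ) * w) = (c₀ : ℂ) * ((D : ℂ) * w) := by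
      push_cast
      field_simp
    rw [this]
    exact hc₀Λ _ (hDΛ w hw)
  exact ⟨C • E, inferInstance, hC, Lg.mulLeft (c : ℂ) hcC, c, hLA, hc, hlat, hAW.symm_of_charZero⟩

end DepletedForm

/-! ## §2. The named facts hold -/

/-- **`eichlerShimura_depletedOptimalQuotient_periodLattice_of_dvd` holds.** For a newform `f ∈ S₂(Γ₀(N))` with integer
coefficients, `S ≠ ∅` a finite set of primes, `N·∏_{ℓ∈S} ℓ² ∣ L`, and the `S`-depleted form `g ∈ S₂(Γ₀(L))`: an elliptic
curve `A/ℚ` (globally minimal), a Néron-type `L_A` and `c ∈ ℚ^×` with `Λ_A = c·Λ_g` and `a_p(A) = a_p(g)` for almost all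
`p`. Proof: `W₀ = E_f = ℂ/Λ_f` is an elliptic curve `y² = x³ + a₄x + a₆` over `ℚ` whose Néron-type lattice is `Λ_f` itself
(`IsNewform0.exists_periodPair_of_coeffField_eq_bot`, `IsNewform0.exists_rat_g₂_g₃_of_lattice_eq_periodLattice`,
`isElliptic_shortModel`, `isNeronLatticeOf_shortModel` — Knapp Thm. 11.74 (d), Cremona §2.14); §1 with `c₀ = 1` gives `A`
with `Λ_A = c·Λ_g` and `A ~_ℚ W₀`; then `L(A, s) = L(W₀, s)` (`IsIsogenous.LFunction_eq`), `a_p(f) = L(W₀, s)_p` for all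
but finitely many `p` (`congruenceRelation_cofinite_of_int`, the Eichler–Shimura congruence for `ℂ/Λ_f`, Shimura Thm.
7.14–7.15 by Honda's method), `a_p(A) = L(A, s)_p` for `p ∤ Δ_min(A)` (`LFunction_apply_prime_eq_frobeniusTrace`), and
`a_p(g) = a_p(f)` for `p ∉ S`; the exceptional primes lie in `{p ≤ |Δ_min(A)|} ∪ S ∪ {congruence exceptions}`.
No modularity, no `eichlerShimuraConstruction`; BSD is not proved. [cite: Knapp1993, Thm. 11.74 (d)(e)]
[cite: ShimuraIATAF1971, Thm. 7.14, Thm. 7.15] [cite: AgasheRibetStein2006, §3 (pp. 620–621)] -/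
theorem eichlerShimura_depletedOptimalQuotient_periodLattice_of_dvd_holds :
    eichlerShimura_depletedOptimalQuotient_periodLattice_of_dvd := by
  intro N _ f hf hint S hS _ L _ hNL _ g hg
  classical
  -- step 1: `W₀ = ℂ/Λ_f` over `ℚ`, Néron lattice `Λ_f`
  have hQ : coeffField f = ⊥ := coeffField_eq_bot_of_forall_exists_intCast hint
  obtain ⟨Lf, hLf⟩ := hf.exists_periodPair_of_coeffField_eq_bot hQ
  obtain ⟨a₄, a₆, h₂, h₃⟩ := hf.exists_rat_g₂_g₃_of_lattice_eq_periodLattice hQ Lf hLf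
  set W₀ : WeierstrassCurve ℚ := { a₁ := 0, a₂ := 0, a₃ := 0, a₄ := a₄, a₆ := a₆ } with hW₀
  haveI hW₀e : W₀.IsElliptic := isElliptic_shortModel h₂ h₃
  have hW₀L : IsNeronLatticeOf (W₀.baseChange ℂ) Lf := isNeronLatticeOf_shortModel h₂ h₃
  have hΛ : ∀ z ∈ periodLattice f, ((1 : ℚ) : ℂ) * z ∈ Lf.lattice := fun z hz ↦ by
    rw [Rat.cast_one, one_mul]
    change z ∈ Lf.lattice.toAddSubgroup
    rw [hLf]
    exact hz
  -- step 2: `A = ℂ/Λ_g` over `ℚ`, globally minimal, `Λ_A = c Λ_g`, `A ~ W₀`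
  obtain ⟨A, hAell, hAmin, LA, c, hLA, hc, hlat, hiso⟩ :=
    DepletedForm.exists_depletedLatticeCurve_isIsogenous_of_mul_mem W₀ hW₀L hf hint one_ne_zero hΛ S hS L hNL g hg
  refine ⟨A, hAell, hAmin, LA, c, hLA, hc, hlat, ?_⟩
  -- step 3: `a_p(A) = a_p(W₀) = a_p(f) = a_p(g)` off a finite set
  have hint' : ∀ n, ∃ m : ℤ, (m : ℂ) = cuspCoeff f n := fun n ↦ (hint n).imp fun m hm ↦ hm.symm
  have hcong := congruenceRelation_cofinite_of_int f hf hint' Lf hLf a₄ a₆ h₂ h₃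
  have hL : W₀.LFunction = A.LFunction := hiso.LFunction_eq
  set D : ℤ := A.minimalDiscriminantInt with hD
  have hD0 : D ≠ 0 := A.minimalDiscriminantInt_ne_zero
  refine ((((Set.finite_Iic D.natAbs).union (S : Set ℕ).toFinite)).union hcong).subset ?_
  rintro p ⟨hp, hne⟩
  by_contra hmem
  simp only [Set.mem_union, Set.mem_Iic, Finset.mem_coe, Set.mem_setOf_eq, not_or] at hmem
  obtain ⟨⟨hpD, hpS⟩, hpC⟩ := hmem
  have hfp : cuspCoeff f p = (W₀.LFunction p : ℂ) := by
    by_contra h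
    exact hpC ⟨hp, h⟩
  haveI : Fact p.Prime := ⟨hp⟩
  have hndvd : ¬ (p : ℤ) ∣ D := fun h ↦ hpD (Nat.le_of_dvd (Int.natAbs_pos.mpr hD0) (Int.ofNat_dvd_left.mp h))
  have hgood : A.HasGoodReductionAtPrime p := WeierstrassCurve.hasGoodReductionAtPrime_of_not_dvd A p hndvd
  apply hne
  rw [hg p, if_neg (by
      rintro ⟨ℓ, hℓ, hd⟩
      exact hpS (((Nat.prime_dvd_prime_iff_eq (hS ℓ hℓ) hp).mp hd) ▸ hℓ)),
    hfp, hL, WeierstrassCurve.LFunction_apply_prime_eq_frobeniusTrace A p hgood]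

/-- **`eichlerShimura_depletedOptimalQuotient_periodLattice` holds** (the fixed level `L = N·∏_{ℓ∈S} ℓ²`): the in-file reduction
`eichlerShimura_depletedOptimalQuotient_periodLattice_of_of_dvd` of `EichlerShimuraOptimalQuotientLattice.lean` applied to
`eichlerShimura_depletedOptimalQuotient_periodLattice_of_dvd_holds`. BSD is not proved.
[cite: Knapp1993, Thm. 11.74 (d)(e)] [cite: AgasheRibetStein2006, §3 (pp. 620–621)] -/
theorem eichlerShimura_depletedOptimalQuotient_periodLattice_holds :
    eichlerShimura_depletedOptimalQuotient_periodLattice :=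
  eichlerShimura_depletedOptimalQuotient_periodLattice_of_of_dvd
    eichlerShimura_depletedOptimalQuotient_periodLattice_of_dvd_holds

end Literature.NumberTheory.EllipticCurves.ModularForms

end
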